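import Mathlib
import HarnessLib
import Literature.Probability.LatticeModels.PointwiseScalingLimitEtaExists
import Summits.CriticalPhenomena.Ising3DConformalLimit.Theses.ThresholdDilation

/-!
# `EtaOfDyadicLaw` — the dyadic scaling law of the critical axis two-point function gives the
# exponent `η` and all-scale doubling (route ThresholdDilation, item stmt-CriticalPhenomena-6326: PROOF)

Setting: the critical nearest-neighbour Ising model on `ℤ³`, axis two-point function
`g(n) = ⟨σ₀σ_{n e₀}⟩⁺_{β_c(3)} = criticalTwoPoint 3 (Pi.single 0 n)`.

Main result `etaOfDyadicLaw_proof` (literally the route decl `EtaOfDyadicLaw`): the dyadic scaling law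
`∃ Δ > 0, g(2n)·4^Δ/g(n) → 1` (`DyadicScalingLaw`) implies
* `∃ η, HasIsingExponentEta 3 η` (the anomalous dimension exists in the tree's logarithmic sense,
  with `η = 2Δ - 1`), and
* all-scale doubling `∃ κ > 0, ∀ n ≥ 1, κ g(n) ≤ g(2n)`.

Mechanism (elementary real analysis over in-tree facts):
1. `tendsto_log_dyadic_div_of_ratio`: along `n = 2^k` the law says
   `log g(2^{k+1}) - log g(2^k) → -Δ log 4 = -2Δ log 2`; Cesàro gives `log g(2^k)/k → -2Δ log 2`.
2. The dyadic fill-in `HasDecayExponent.of_dyadic_of_antitone` (Messager–Miracle-Solé axis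
   monotonicity `criticalTwoPoint_axis_antitone`, positivity `criticalTwoPoint_axis_pos`) gives the axis
   exponent `log g(m)/log m → -2Δ`.
3. `hasIsingExponentEta_of_hasDecayExponent_axis`: all directions by the MMS sphere sandwich
   `g(3‖y‖_∞) ≤ ⟨σ₀σ_y⟩ ≤ g(‖y‖_∞)` (`criticalTwoPoint_axis_sandwich`), so `η = 2Δ - 1`.
4. `exists_doubling_of_ratio`: eventually `g(2n)·4^Δ/g(n) ≥ 1/2`, i.e. `g(2n) ≥ g(n)/(2·4^Δ)`; the
   finitely many small `n` are covered by monotonicity and `g ≤ 1`.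

References: H. Duminil-Copin, *100 years of the (critical) Ising model on the hypercubic lattice*,
Proc. ICM 2022, §4.2.1 (the exponent `η` in the logarithmic sense); A. Messager, S. Miracle-Solé,
J. Stat. Phys. 17 (1977) (monotonicity of correlations). No definitions are introduced.
-/

noncomputable section

namespace Summit.CriticalPhenomena.Ising3DConformalLimit.Theorems.ThresholdDilationEta

open Filter Topology Set
open Literature.Probability.LatticeModels
open Summit.CriticalPhenomena.Ising3DConformalLimit.Theses.ThresholdDilation

/-! ### Real analysis -/

/-- **Cesàro along dyadic scales.** If `g > 0` and `g(2n)·4^Δ/g(n) → 1`, then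
`log g(2^k) / k → -(2Δ) log 2`: the increments `log g(2^{k+1}) - log g(2^k)` tend to `-Δ log 4`
and telescope. [folklore] -/
theorem tendsto_log_dyadic_div_of_ratio {g : ℕ → ℝ} (hpos : ∀ m, 0 < g m) {Δ : ℝ}
    (h : Tendsto (fun n : ℕ => g (2 * n) * (4 : ℝ) ^ Δ / g n) atTop (𝓝 1)) :
    Tendsto (fun k : ℕ => Real.log (g (2 ^ k)) / k) atTop (𝓝 (-(2 * Δ) * Real.log 2)) := by
  have h4 : 0 < (4 : ℝ) ^ Δ := Real.rpow_pos_of_pos (by norm_num) _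
  have hlog4 : Real.log ((4 : ℝ) ^ Δ) = 2 * Δ * Real.log 2 := by
    rw [Real.log_rpow (by norm_num), show (4 : ℝ) = 2 ^ 2 by norm_num, Real.log_pow]
    push_cast
    ring
  -- increments
  have hincr : Tendsto (fun k : ℕ => Real.log (g (2 ^ (k + 1))) - Real.log (g (2 ^ k))) atTop
      (𝓝 (-(2 * Δ) * Real.log 2)) := by
    have hpow : Tendsto (fun k : ℕ => 2 ^ k) atTop atTop := tendsto_pow_atTop_atTop_of_one_lt one_lt_two
    have h1 := h.comp hpow
    have h2 := ((Real.continuousAt_log one_ne_zero).tendsto.comp h1).sub_const (Real.log ((4 : ℝ) ^ Δ))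
    rw [Real.log_one, zero_sub, hlog4, show -(2 * Δ * Real.log 2) = -(2 * Δ) * Real.log 2 by ring] at h2
    refine h2.congr fun k => ?_
    simp only [Function.comp_apply]
    rw [show 2 * 2 ^ k = 2 ^ (k + 1) from (pow_succ' 2 k).symm,
      Real.log_div (mul_pos (hpos _) h4).ne' (hpos _).ne', Real.log_mul (hpos _).ne' h4.ne', hlog4]
    ring
  -- Cesàro
  have hu := hincr.cesaro
  have h0 : Tendsto (fun n : ℕ => Real.log (g (2 ^ 0)) / (n : ℝ)) atTop (𝓝 0) :=
    tendsto_const_div_atTop_nhds_zero_nat _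
  have hsum := hu.add h0
  rw [add_zero] at hsum
  refine hsum.congr' ?_
  filter_upwards [eventually_gt_atTop 0] with n hn
  rw [Finset.sum_range_sub (fun k => Real.log (g (2 ^ k))) n]
  have hn' : (n : ℝ) ≠ 0 := by exact_mod_cast hn.ne'
  field_simp
  ring

/-- **All-scale doubling from the dyadic law.** If `0 < g ≤ 1` is antitone and
`g(2n)·4^Δ/g(n) → 1`, then `κ g(n) ≤ g(2n)` for all `n ≥ 1` with one `κ > 0`: eventually
`g(2n) ≥ g(n) / (2·4^Δ)`, and for the finitely many `n < N` one has `κ g(n) ≤ g(2N) ≤ g(2n)`.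
[folklore] -/
theorem exists_doubling_of_ratio {g : ℕ → ℝ} (hpos : ∀ m, 0 < g m) (hanti : Antitone g)
    (hle : ∀ m, g m ≤ 1) {Δ : ℝ}
    (h : Tendsto (fun n : ℕ => g (2 * n) * (4 : ℝ) ^ Δ / g n) atTop (𝓝 1)) :
    ∃ κ : ℝ, 0 < κ ∧ ∀ n : ℕ, 1 ≤ n → κ * g n ≤ g (2 * n) := by
  have h4 : 0 < (4 : ℝ) ^ Δ := Real.rpow_pos_of_pos (by norm_num) _
  have hev : ∀ᶠ n : ℕ in atTop, (1 / 2 : ℝ) < g (2 * n) * (4 : ℝ) ^ Δ / g n :=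
    h.eventually (lt_mem_nhds (by norm_num))
  obtain ⟨N, hN⟩ := eventually_atTop.1 hev
  refine ⟨min (1 / (2 * (4 : ℝ) ^ Δ)) (g (2 * N)), lt_min (by positivity) (hpos _), fun n _hn => ?_⟩
  by_cases hnN : N ≤ n
  · -- tail: the eventual ratio bound
    have hr := hN n hnN
    have hgn := hpos n
    rw [lt_div_iff₀ hgn] at hr
    calc min (1 / (2 * (4 : ℝ) ^ Δ)) (g (2 * N)) * g n ≤ 1 / (2 * (4 : ℝ) ^ Δ) * g n :=
          mul_le_mul_of_nonneg_right (min_le_left _ _) hgn.le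
      _ = (1 / 2 * g n) / (4 : ℝ) ^ Δ := by field_simp
      _ ≤ g (2 * n) * (4 : ℝ) ^ Δ / (4 : ℝ) ^ Δ := div_le_div_of_nonneg_right hr.le h4.le
      _ = g (2 * n) := by field_simp
  · -- head: monotonicity
    have hlt : n ≤ N := (not_le.1 hnN).le
    calc min (1 / (2 * (4 : ℝ) ^ Δ)) (g (2 * N)) * g n ≤ g (2 * N) * g n :=
          mul_le_mul_of_nonneg_right (min_le_right _ _) (hpos n).le
      _ ≤ g (2 * N) * 1 := mul_le_mul_of_nonneg_left (hle n) (hpos _).le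
      _ = g (2 * N) := mul_one _
      _ ≤ g (2 * n) := hanti (Nat.mul_le_mul_left 2 hlt)

/-! ### From the axis exponent to `η` -/

/-- **Axis exponent ⇒ `η`.** If the critical axis two-point function on `ℤ³` has decay exponent `L`
(`log ⟨σ₀σ_{m e₀}⟩_{β_c} / log m → -L`), then `HasIsingExponentEta 3 (L - 1)`: all directions follow
from the Messager–Miracle-Solé sphere sandwich `⟨σ₀σ_{3n e₀}⟩ ≤ ⟨σ₀σ_y⟩ ≤ ⟨σ₀σ_{n e₀}⟩`, `‖y‖_∞ = n`
(`criticalTwoPoint_axis_sandwich`) and `log (3m)/log m → 1`; the bookkeeping is that of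
`HasPointwiseScalingLimit.hasIsingExponentEta`. [cite: DuminilCopin2019, Exercise 37 (4), eq. (4.10), §4.3] -/
theorem hasIsingExponentEta_of_hasDecayExponent_axis {L : ℝ}
    (hax : HasDecayExponent (fun m : ℕ => criticalTwoPoint 3 (Pi.single 0 (m : ℤ))) L) :
    HasIsingExponentEta 3 (L - 1) := by
  have hax3 := hax.comp_three_mul
  unfold HasDecayExponent at hax hax3
  have hn : Tendsto (fun y : Site 3 => Site.supNorm y) cofinite atTop := by
    have h := Site.tendsto_norm_cofinite_atTop (d := 3)
    simp_rw [Site.norm_eq_supNorm] at h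
    exact tendsto_natCast_atTop_iff.1 h
  have hUp := hax.comp hn
  have hLo := hax3.comp hn
  have key : Tendsto (fun y : Site 3 => Real.log (criticalTwoPoint 3 y) / Real.log ‖y‖) cofinite
      (𝓝 (-L)) := by
    refine tendsto_of_tendsto_of_tendsto_of_le_of_le' hLo hUp ?_ ?_
    · filter_upwards [hn.eventually (eventually_gt_atTop 1)] with y hy
      obtain ⟨hlo, -⟩ := criticalTwoPoint_axis_sandwich hy.le
      have hlog : 0 < Real.log ((Site.supNorm y : ℕ) : ℝ) := Real.log_pos (by exact_mod_cast hy)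
      simp only [Function.comp_apply]
      rw [Site.norm_eq_supNorm]
      push_cast at hlo ⊢
      exact div_le_div_of_nonneg_right (Real.log_le_log (criticalTwoPoint_axis_pos _) (by
        simpa only [Nat.cast_mul, Nat.cast_ofNat] using hlo)) hlog.le
    · filter_upwards [hn.eventually (eventually_gt_atTop 1)] with y hy
      obtain ⟨hlo, hup⟩ := criticalTwoPoint_axis_sandwich hy.le
      have hlog : 0 < Real.log ((Site.supNorm y : ℕ) : ℝ) := Real.log_pos (by exact_mod_cast hy)
      have hpos : 0 < criticalTwoPoint 3 y := (criticalTwoPoint_axis_pos _).trans_le hlo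
      simp only [Function.comp_apply]
      rw [Site.norm_eq_supNorm]
      exact div_le_div_of_nonneg_right (Real.log_le_log hpos hup) hlog.le
  unfold HasIsingExponentEta HasSpatialDecayExponent
  convert key using 2
  push_cast
  ring

/-- **Axis exponent from the dyadic law.** If `g(2n)·4^Δ/g(n) → 1` for the critical axis two-point
function `g` on `ℤ³`, then `log g(m)/log m → -2Δ` (Cesàro along dyadic scales, then the dyadic fill-in
by Messager–Miracle-Solé axis monotonicity). [cite: MessagerMiracleSoleJSP1977, main theorem (monotonicity of ⟨σ₀σ_x⟩ under reflections)] -/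
theorem hasDecayExponent_axis_of_dyadic {Δ : ℝ}
    (h : Tendsto (fun n : ℕ => criticalTwoPoint 3 (Pi.single 0 ((2 * n : ℕ) : ℤ)) * (4 : ℝ) ^ Δ /
      criticalTwoPoint 3 (Pi.single 0 ((n : ℕ) : ℤ))) atTop (𝓝 1)) :
    HasDecayExponent (fun m : ℕ => criticalTwoPoint 3 (Pi.single 0 (m : ℤ))) (2 * Δ) :=
  HasDecayExponent.of_dyadic_of_antitone criticalTwoPoint_axis_pos criticalTwoPoint_axis_antitone
    (tendsto_log_dyadic_div_of_ratio (g := fun m : ℕ => criticalTwoPoint 3 (Pi.single 0 (m : ℤ)))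
      criticalTwoPoint_axis_pos h)

/-! ### The item -/

/-- **`EtaOfDyadicLaw`** (route ThresholdDilation, item stmt-CriticalPhenomena-6326): the dyadic
scaling law `∃ Δ > 0, g(2n)·4^Δ/g(n) → 1` of the critical axis two-point function
`g(n) = ⟨σ₀σ_{n e₀}⟩⁺_{β_c(3)}` implies (a) the anomalous dimension exists in the logarithmic sense,
`HasIsingExponentEta 3 (2Δ - 1)`, and (b) all-scale doubling `∃ κ > 0, ∀ n ≥ 1, κ g(n) ≤ g(2n)`.
[cite: DuminilCopinICM2022, §4.2.1 p. 12] -/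
theorem etaOfDyadicLaw_proof : EtaOfDyadicLaw := by
  unfold EtaOfDyadicLaw DyadicScalingLaw
  rintro ⟨Δ, _hΔ, hlim⟩
  refine ⟨⟨2 * Δ - 1, hasIsingExponentEta_of_hasDecayExponent_axis (hasDecayExponent_axis_of_dyadic hlim)⟩,
    ?_⟩
  exact exists_doubling_of_ratio (g := fun m : ℕ => criticalTwoPoint 3 (Pi.single 0 (m : ℤ)))
    criticalTwoPoint_axis_pos criticalTwoPoint_axis_antitone (fun m => criticalTwoPoint_le_one' _) hlim

end Summit.CriticalPhenomena.Ising3DConformalLimit.Theorems.ThresholdDilationEta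

end
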